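import Summits.NavierStokesRegularity.NavierStokesRegularity.Theorems.SoloRefuteHaitani2025B0Ortho
import Summits.NavierStokesRegularity.NavierStokesRegularity.Theorems.SoloRefuteHaitani2025B0Field
import HarnessLib

/-!
# C133 `Haitani2025` — B₀, file F3: Fubini on `Ω`, the `L²` identities, `B0 : WaveletSystem`

Towards the case-(α) ADDENDUM `¬ Step1_Display13 B₀` to ADJUDICATED #115 (locator
`Literature.Claims.NS.Haitani2025.Step1_Display13` = display (13) p.4; chair 2026-08-27T05:18:12Z; design refuter-8 g2,
B0/PLAN.md; chain F1a → F1b → F1c → F2 → F3 → F4). Over F1b/F1c (exact 1-D integrals and 1-D dyadic orthogonality,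
refuter-8 g2) and F2 (the fields `ψ_a`, refuter-6 g2):
* `integral_HOmega_tensor`: for factors vanishing off `(0,1)`, `∫_Ω ∏ᵢ fᵢ(xᵢ) dx = ∏ᵢ ∫₀¹ fᵢ` (zero-extension to `ℝ³`,
  the volume-preserving `toLp : (Fin 3 → ℝ) ≃ ℝ³`, Mathlib's `integral_fintype_prod_volume_eq_prod`; no integrability
  hypothesis), and `integrable_tensor`;
* Definition 1 item 3: `l2Sq_psi : ‖ψ_a‖²_{L²(Ω)} = 1`, `integral_inner_psi_psi : ∫_Ω ψ_a·ψ_b = 0` (`a ≠ b`);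
  item 4 exactly: `gradL2Sq_psi : ‖∇ψ_a‖²_{L²(Ω)} = 2340·4^k`;
* the trilinear form of (13) on a pair of fields: `trilinear_psi` (general `a`, `b`) and `trilinear_child`
  (`v = ψ_{k,j}`, `w = ψ_{k+1,2j}`: `∫_Ω v·(w·∇)v = amp_k² amp_{k+1} 2^k · (N₀/2^k) · (M₀/2^k)²`,
  `N₀ = −21313/44609044480`, `M₀ = −1691/160592560128`);
* **`B0 : WaveletSystem`** — all seven Definition-1 fields discharged (`C = 49` in item 4, `49² ≥ 2340`), with
  `B0_ψ : B0.ψ = psi`, `psi_mem_levelSpan : ψ_{k,j} ∈ V_k(B₀)`, `l2Sq_B0`, `gradL2Sq_B0`.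
F4 (`SoloRefuteHaitani2025B0Kill.lean`, refuter-8 g2) compares `trilinear_child` with the right-hand side of (13).
[cite: Haitani2025NavierStokesGitHub, Definition 1 p.2; (13) p.4]

WHAT THIS IS NOT: not a claim about NS regularity or blow-up; not a claim about any author beyond the typed locator.
-/

set_option linter.dupNamespace false

open Set Function MeasureTheory
open scoped Topology InnerProductSpace RealInnerProductSpace

namespace Summit.NavierStokesRegularity.NavierStokesRegularity.Theorems.Haitani2025.B0

open Literature.Claims.NS.Haitani2025 Literature.Analysis.FluidPDE
open Literature.Claims.NS.Chio2026 (E3 gradSq)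

noncomputable section
/-! ### Fubini on the cube, the `L²` identities, `B0 : WaveletSystem` -/

/-! #### Fubini: a tensor product integrates over `Ω` to the product of the three `∫₀¹` -/

/-- A 1-D factor vanishing off `(0,1)` has support in `[0,1]`, hence in `Ioc 0 1`. [folklore] -/
theorem support_subset_Ioc {g : ℝ → ℝ} (hg : ∀ t, t ∉ Ioo (0:ℝ) 1 → g t = 0) :
    support g ⊆ Ioc (0:ℝ) 1 := by
  intro t ht
  by_contra h
  exact ht (hg t fun h' => h (Ioo_subset_Ioc_self h'))

/-- **Fubini on the open unit cube for tensor products.** If each factor vanishes off `(0,1)`, then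
`∫_Ω ∏ᵢ fᵢ(xᵢ) dx = ∏ᵢ ∫₀¹ fᵢ` (zero-extension to `ℝ³`, the volume-preserving `toLp : (Fin 3 → ℝ) ≃ ℝ³`,
Mathlib's `integral_fintype_prod_volume_eq_prod`). No integrability hypothesis is needed. [folklore] -/
theorem integral_HOmega_tensor (f : Fin 3 → ℝ → ℝ) (hf : ∀ i t, t ∉ Ioo (0:ℝ) 1 → f i t = 0) :
    ∫ x in HOmega, ∏ i, f i (x i) = ∏ i, ∫ t in (0:ℝ)..1, f i t := by
  rw [setIntegral_eq_integral_of_forall_compl_eq_zero (fun x hx => ?_)]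
  · rw [← (PiLp.volume_preserving_toLp (Fin 3)).integral_comp (MeasurableEquiv.toLp 2 _).measurableEmbedding,
      integral_fintype_prod_volume_eq_prod]
    refine Finset.prod_congr rfl fun i _ => ?_
    rw [intervalIntegral.integral_eq_integral_of_support_subset (support_subset_Ioc (hf i))]
  · simp only [HOmega, mem_setOf_eq, not_forall] at hx
    obtain ⟨i, hi⟩ := hx
    exact Finset.prod_eq_zero (Finset.mem_univ i) (hf i _ hi)

/-- **Integrability of tensor products** of continuous factors vanishing off `(0,1)`. [folklore] -/
theorem integrable_tensor (f : Fin 3 → ℝ → ℝ) (hc : ∀ i, Continuous (f i))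
    (hf : ∀ i t, t ∉ Ioo (0:ℝ) 1 → f i t = 0) :
    Integrable (fun x : E3 => ∏ i, f i (x i)) := by
  rw [← (PiLp.volume_preserving_toLp (Fin 3)).integrable_comp_emb
    (MeasurableEquiv.toLp 2 _).measurableEmbedding]
  have h : Integrable (fun y : Fin 3 → ℝ => ∏ i, f i (y i)) (Measure.pi fun _ => volume) :=
    Integrable.fintype_prod fun i => (hc i).integrable_of_hasCompactSupport
      (HasCompactSupport.of_support_subset_isCompact isCompact_Icc
        ((support_subset_Ioc (hf i)).trans Ioc_subset_Icc_self))
  simpa [Function.comp_def, volume_pi] using h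

/-! #### the 1-D factors of `ψ_a` vanish off `(0,1)` -/

/-- `sp(2^k t − j) = 0` for `t ∉ (0,1)` when `j < 2^k`. [folklore] -/
theorem spS_eq_zero_of_not_mem {k : ℕ} (j : Fin (2 ^ k)) {t : ℝ} (ht : t ∉ Ioo (0:ℝ) 1) :
    spS k j t = 0 := by
  rw [mem_Ioo, not_and_or, not_lt, not_lt] at ht
  rcases ht with h | h
  · exact spS_eq_zero_of_le (h.trans (by positivity))
  · refine spS_eq_zero_of_ge (le_trans ?_ h)
    rw [div_le_one (by positivity)]
    exact_mod_cast Nat.succ_le_of_lt j.isLt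

/-- `sp′(2^k t − j) = 0` for `t ∉ (0,1)` when `j < 2^k`. [folklore] -/
theorem dspS_eq_zero_of_not_mem {k : ℕ} (j : Fin (2 ^ k)) {t : ℝ} (ht : t ∉ Ioo (0:ℝ) 1) :
    dspS k j t = 0 := by
  rw [mem_Ioo, not_and_or, not_lt, not_lt] at ht
  rcases ht with h | h
  · exact dspS_eq_zero_of_le (h.trans (by positivity))
  · refine dspS_eq_zero_of_ge (le_trans ?_ h)
    rw [div_le_one (by positivity)]
    exact_mod_cast Nat.succ_le_of_lt j.isLt

/-! #### `L²` identities -/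

/-- **Definition 1 item 3 (diagonal): `‖ψ_a‖²_{L²(Ω)} = 1`.** [folklore] -/
theorem l2Sq_psi (a : Idx) : l2Sq (psi a) = 1 := by
  unfold l2Sq
  simp_rw [norm_psi_sq]
  rw [MeasureTheory.integral_const_mul, integral_HOmega_tensor (fun i t => spS a.1 (a.2 i) t ^ 2)
    (fun i t ht => by rw [spS_eq_zero_of_not_mem (a.2 i) ht, zero_pow two_ne_zero])]
  simp_rw [integral_spS_sq (Fin.isLt _)]
  rw [Finset.prod_const, Finset.card_univ, Fintype.card_fin, amp_sq]
  field_simp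

/-- **Definition 1 item 3 (off-diagonal): `∫_Ω ψ_a·ψ_b = 0` for `a ≠ b`** (one coordinate carries two
different dyadic factors, whose 1-D integral vanishes). [folklore] -/
theorem integral_inner_psi_psi {a b : Idx} (hab : a ≠ b) :
    ∫ x in HOmega, ⟪psi a x, psi b x⟫_ℝ = 0 := by
  simp_rw [inner_psi_psi]
  rw [MeasureTheory.integral_const_mul, integral_HOmega_tensor (fun i t => spS a.1 (a.2 i) t * spS b.1 (b.2 i) t)
    (fun i t ht => by rw [spS_eq_zero_of_not_mem (a.2 i) ht, zero_mul])]
  -- some coordinate `i` has `(k, j i) ≠ (k', j' i)`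
  obtain ⟨i, hi⟩ : ∃ i : Fin 3, (⟨a.1, (a.2 i : ℕ)⟩ : ℕ × ℕ) ≠ ⟨b.1, (b.2 i : ℕ)⟩ := by
    by_contra h
    push Not at h
    obtain ⟨k, j⟩ := a
    obtain ⟨k', j'⟩ := b
    have hk : k = k' := congrArg Prod.fst (h 0)
    subst hk
    exact hab (by
      congr 1
      funext i
      exact Fin.ext (congrArg Prod.snd (h i)))
  rw [Finset.prod_eq_zero (Finset.mem_univ i) (integral_spS_mul_spS (a.2 i).isLt (b.2 i).isLt hi), mul_zero]

/-- integrability of the summands of `|∇ψ_a|²`. [folklore] -/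
theorem integrable_dtens_sq (a : Idx) (i : Fin 3) : Integrable (fun x : E3 => dtens a i x ^ 2) := by
  simp_rw [dtens_sq]
  refine (integrable_tensor (fun l t => if l = i then dspS a.1 (a.2 l) t ^ 2 else spS a.1 (a.2 l) t ^ 2)
    (fun l => ?_) (fun l t ht => ?_)).const_mul _
  · split_ifs
    · exact (continuous_dspS _ _).pow 2
    · exact (continuous_spS _ _).pow 2
  · split_ifs
    · rw [dspS_eq_zero_of_not_mem (a.2 l) ht, zero_pow two_ne_zero]
    · rw [spS_eq_zero_of_not_mem (a.2 l) ht, zero_pow two_ne_zero]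

/-- **`‖∇ψ_a‖²_{L²(Ω)} = 2340 · 4^k`** (`= amp_k² · 4^k · 3 · (2/77·2^{-k}) · (1/30030·2^{-k})²`). [folklore] -/
theorem gradL2Sq_psi (a : Idx) : gradL2Sq (psi a) = 2340 * 4 ^ a.1 := by
  unfold gradL2Sq
  simp_rw [gradSq_psi]
  rw [MeasureTheory.integral_const_mul, MeasureTheory.integral_finsetSum _ (fun i _ => (integrable_dtens_sq a i).integrableOn)]
  simp_rw [dtens_sq]
  have h : ∀ i : Fin 3, ∫ x in HOmega, (4 : ℝ) ^ a.1 * ∏ l, (if l = i then dspS a.1 (a.2 l) (x l) ^ 2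
      else spS a.1 (a.2 l) (x l) ^ 2) = 4 ^ a.1 * (2 / (77 * 2 ^ a.1) * (1 / (30030 * 2 ^ a.1)) ^ 2) := by
    intro i
    rw [MeasureTheory.integral_const_mul, integral_HOmega_tensor (fun l t => if l = i then dspS a.1 (a.2 l) t ^ 2
      else spS a.1 (a.2 l) t ^ 2) (fun l t ht => ?_)]
    · congr 1
      have hl : ∀ l : Fin 3, (∫ t in (0:ℝ)..1, if l = i then dspS a.1 (a.2 l) t ^ 2 else spS a.1 (a.2 l) t ^ 2)
          = if l = i then 2 / (77 * 2 ^ a.1) else 1 / (30030 * 2 ^ a.1) := by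
        intro l
        split_ifs
        · exact integral_dspS_sq (Fin.isLt _)
        · exact integral_spS_sq (Fin.isLt _)
      simp_rw [hl]
      rw [prod_ite_eq_mul_prod_erase i (fun _ => 2 / (77 * 2 ^ a.1)) (fun _ => 1 / (30030 * 2 ^ a.1)),
        Finset.prod_const, Finset.card_erase_of_mem (Finset.mem_univ i), Finset.card_univ, Fintype.card_fin]
    · split_ifs
      · rw [dspS_eq_zero_of_not_mem (a.2 l) ht, zero_pow two_ne_zero]
      · rw [spS_eq_zero_of_not_mem (a.2 l) ht, zero_pow two_ne_zero]
  simp_rw [h]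
  rw [Finset.sum_const, Finset.card_univ, Fintype.card_fin, nsmul_eq_mul, Nat.cast_ofNat, amp_sq]
  have hK : (2:ℝ) ^ a.1 ≠ 0 := by positivity
  generalize (2:ℝ) ^ a.1 = K at hK ⊢
  field_simp
  ring

/-! #### the trilinear form of display (13) on the pair `(ψ_a, ψ_b)` -/

/-- **`∫_Ω ψ_a·(ψ_b·∇)ψ_a = amp_a² amp_b 2^k · N · ∏_{l ≠ 0} M_l`**, with the 1-D integrals
`N = ∫₀¹ sp_a sp′_a sp_b` (coordinate 0) and `M_l = ∫₀¹ sp_a² sp_b` (coordinates 1, 2). [folklore] -/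
theorem trilinear_psi (a b : Idx) :
    ∫ x in HOmega, ⟪psi a x, convect (psi b) (psi a) x⟫_ℝ =
      amp a.1 ^ 2 * amp b.1 * (2 ^ a.1 *
        ((∫ t in (0:ℝ)..1, spS a.1 (a.2 0) t * dspS a.1 (a.2 0) t * spS b.1 (b.2 0) t) *
          ∏ l ∈ Finset.univ.erase (0 : Fin 3), ∫ t in (0:ℝ)..1, spS a.1 (a.2 l) t ^ 2 * spS b.1 (b.2 l) t)) := by
  simp_rw [inner_psi_convect, tens_dtens_tens]
  rw [MeasureTheory.integral_const_mul, MeasureTheory.integral_const_mul, integral_HOmega_tensor (fun l t => if l = 0 then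
      spS a.1 (a.2 l) t * dspS a.1 (a.2 l) t * spS b.1 (b.2 l) t else spS a.1 (a.2 l) t ^ 2 * spS b.1 (b.2 l) t)
    (fun l t ht => ?_)]
  · have hl : ∀ l : Fin 3, (∫ t in (0:ℝ)..1, if l = 0 then
        spS a.1 (a.2 l) t * dspS a.1 (a.2 l) t * spS b.1 (b.2 l) t else spS a.1 (a.2 l) t ^ 2 * spS b.1 (b.2 l) t)
        = if l = 0 then ∫ t in (0:ℝ)..1, spS a.1 (a.2 l) t * dspS a.1 (a.2 l) t * spS b.1 (b.2 l) t
          else ∫ t in (0:ℝ)..1, spS a.1 (a.2 l) t ^ 2 * spS b.1 (b.2 l) t := by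
      intro l
      split_ifs <;> rfl
    simp_rw [hl]
    rw [prod_ite_eq_mul_prod_erase 0
      (fun l => ∫ t in (0:ℝ)..1, spS a.1 (a.2 l) t * dspS a.1 (a.2 l) t * spS b.1 (b.2 l) t)
      (fun l => ∫ t in (0:ℝ)..1, spS a.1 (a.2 l) t ^ 2 * spS b.1 (b.2 l) t)]
  · split_ifs
    · rw [spS_eq_zero_of_not_mem (a.2 l) ht, zero_mul, zero_mul]
    · rw [spS_eq_zero_of_not_mem (a.2 l) ht, zero_pow two_ne_zero, zero_mul]

/-- The `ε = 0` child position `2j` at level `k+1` of a position `j` at level `k`. [folklore] -/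
def child {k : ℕ} (j : Fin 3 → Fin (2 ^ k)) : Fin 3 → Fin (2 ^ (k + 1)) :=
  fun i => ⟨2 * (j i : ℕ), by rw [pow_succ]; have := (j i).isLt; omega⟩

/-- `(child j) i = 2 jᵢ`. [folklore] -/
@[simp] theorem child_val {k : ℕ} (j : Fin 3 → Fin (2 ^ k)) (i : Fin 3) : ((child j i : ℕ) : ℝ) = 2 * (j i : ℕ) := by
  simp [child]

/-- **The trilinear value on the parent/child pair**: with `v = ψ_{k,j}`, `w = ψ_{k+1,2j}`,
`∫_Ω v·(w·∇)v = amp_k² amp_{k+1} 2^k · (N₀/2^k) · (M₀/2^k)²`, `N₀ = −21313/44609044480`,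
`M₀ = −1691/160592560128` (the exact 1-D integrals of F1b). [folklore] -/
theorem trilinear_child (k : ℕ) (j : Fin 3 → Fin (2 ^ k)) :
    ∫ x in HOmega, ⟪psi ⟨k, j⟩ x, convect (psi ⟨k + 1, child j⟩) (psi ⟨k, j⟩) x⟫_ℝ =
      amp k ^ 2 * amp (k + 1) * (2 ^ k *
        ((-21313 / 44609044480 / 2 ^ k) * (-1691 / 160592560128 / 2 ^ k) ^ 2)) := by
  rw [trilinear_psi]
  have hN : (∫ t in (0:ℝ)..1, spS k (j 0) t * dspS k (j 0) t * spS (k + 1) (child j 0) t)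
      = -21313 / 44609044480 / 2 ^ k := by
    have h := integral_spS_dspS_child (k := k) (j := (j 0 : ℕ)) (Fin.isLt _)
    simpa [child, Nat.cast_mul] using h
  have hM : ∀ l : Fin 3, (∫ t in (0:ℝ)..1, spS k (j l) t ^ 2 * spS (k + 1) (child j l) t)
      = -1691 / 160592560128 / 2 ^ k := by
    intro l
    have h := integral_spS_sq_mul_child (k := k) (j := (j l : ℕ)) (Fin.isLt _)
    simpa [child, Nat.cast_mul] using h
  simp only [hN, hM, Finset.prod_const, Finset.card_erase_of_mem (Finset.mem_univ (0 : Fin 3)),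
    Finset.card_univ, Fintype.card_fin]

/-! #### the Definition-1 system `B0` -/

/-- **`B₀`: an explicit Definition-1 «boundary-adaptive wavelet system»** — tensor products of the clamped
degree-6 `C¹` spline with 7 vanishing moments, pointing along `e₀`; all seven fields exact
(`C = 49`, `49² = 2401 ≥ 2340`, in item 4). [cite: Haitani2025NavierStokesGitHub, Definition 1 p.2] -/
def B0 : WaveletSystem where
  ψ := psi
  contDiff := contDiff_psi
  support := tsupport_psi
  boundary := psi_boundary
  norm_one := l2Sq_psi
  orthogonal := fun _ _ hab => integral_inner_psi_psi hab
  gradBound := ⟨49, fun a => by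
    rw [gradL2Sq_psi, l2Sq_psi, mul_one]
    exact mul_le_mul_of_nonneg_right (by norm_num) (by positivity)⟩

/-- `B0.ψ = psi` (definitional). [folklore] -/
@[simp] theorem B0_ψ : B0.ψ = psi := rfl

/-- `ψ_{k,j} ∈ V_k(B₀)` (coefficients `δ_{j j'}`). [folklore] -/
theorem psi_mem_levelSpan (k : ℕ) (j : Fin 3 → Fin (2 ^ k)) : psi ⟨k, j⟩ ∈ levelSpan B0 k := by
  refine ⟨fun j' => if j' = j then 1 else 0, funext fun x => ?_⟩
  simp [Finset.sum_ite_eq']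

/-- the exact gradient norm at the instance, restated through `B0.ψ`. [folklore] -/
theorem gradL2Sq_B0 (a : Idx) : gradL2Sq (B0.ψ a) = 2340 * 4 ^ a.1 := gradL2Sq_psi a

/-- the unit norm at the instance, restated through `B0.ψ`. [folklore] -/
theorem l2Sq_B0 (a : Idx) : l2Sq (B0.ψ a) = 1 := l2Sq_psi a

end

end Summit.NavierStokesRegularity.NavierStokesRegularity.Theorems.Haitani2025.B0

-- WHAT THIS IS NOT: not a claim about NS regularity or blow-up; not a claim about any author beyond the typed locator.
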